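import Literature.Geometry.Kaehler.HolomorphicChainOrthoChart
import Literature.Geometry.Kaehler.ChainSheetFormula
import Literature.Geometry.Kaehler.AnalyticSetChain
import HarnessLib

/-!
# Sheets of the regular locus of an analytic set: local parametrisation and transport of measure

Layer `Literature/Geometry/Kaehler`; lane `lit-hodgefound`, programme «CHAIN COMPACTNESS», file F4a
(infrastructure for the identification of weak limits of holomorphic chains,
[Chirka1989, §16.1 Prop. 1]: "if `a ∈ reg A` … everything may be considered in `ℂⁿ` … the
multiplicity of `T` in a neighborhood of `a`", p. 207).

Let `A ⊆ Ω` be an analytic subset of pure dimension `p = q + 1` of an open subset `Ω` of a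
finite-dimensional complex inner product space `V`, and `b ∈ reg A` (a point of the carrier of the
chain `[A] = HolomorphicChain.ofSet A`). This file packages the local structure of `reg A` at `b`
in the form used by measure-theoretic arguments on currents carried by `A`:

* `HolomorphicChain.exists_sheet_nhds` — **a sheet neighbourhood**: inside any open `U ∋ b` there
  are the tangent `p`-plane `K` (a complex subspace, `ℓ` the orthogonal projection onto it), a
  radius `δ > 0`, a holomorphic section `s` of `ℓ` over the ball `W = B(ℓ b, δ) ⊆ K` and an open
  tube `O ∋ b`, `O ⊆ U ∩ Ω`, such that `reg A ∩ O = s(W)` EXACTLY (the orthogonally normalised chart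
  of `exists_orthoChart`, [Chirka1989, §2.3], cut down to a tube over a small ball);
* `HolomorphicChain.measure_inter_preimage_eq_zero_of_sheet` — **null sets of the sheet pull back
  to null sets of the base** (`𝓗^{2p}(N) = 0 ⇒ 𝓗^{2p}(S ∩ s⁻¹N) = 0`), from the Wirtinger area
  formula `∫_{s(S)} g = ∫_S g(s t) J(t)`, `J = (normDet ∂s)² > 0` [Federer1969, 3.2.5];
* `HolomorphicChain.aestronglyMeasurable_comp_sheet` — a.e.-(strongly) measurable functions on the
  sheet compose with `s` to a.e.-measurable functions on the base;
* `HolomorphicChain.integral_image_sheet_eq` — **the area formula for Bochner integrals over a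
  sheet**: `∫_{s(S)} h d𝓗^{2p} = ∫_S h(s t) (normDet ∂s(t))² d𝓗^{2p}(t)` for `h` integrable on
  `s(S)`.

Theorems only; no new definitions, no named facts.

## References

* [Chirka1989] E. M. Chirka, *Complex Analytic Sets*, Kluwer 1989, §2.3 (regular points),
  §16.1, p. 207.
* [Federer1969] H. Federer, *Geometric Measure Theory*, Springer 1969, 3.2.3, 3.2.5.
-/

noncomputable section

open scoped Manifold Topology ENNReal NNReal InnerProductSpace
open Set Filter MeasureTheory Metric Module Function TopologicalSpace

namespace Literature.Geometry.Kaehler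

open Literature.Geometry.GeometricMeasureTheory

universe u

variable {V : Type u} [NormedAddCommGroup V] [InnerProductSpace ℂ V] [FiniteDimensional ℂ V]
  [MeasurableSpace V] [BorelSpace V] {Ω : Opens V} {q : ℕ}

namespace HolomorphicChain

/-! ### A sheet neighbourhood of a regular point -/

/-- **Sheet neighbourhood of a point of the carrier of a holomorphic chain.** Let `T` be a
holomorphic `p`-chain on `Ω` (`p = q + 1`), `b ∈ reg|T|` and `U ∋ b` open. Then there are a complex
`p`-plane `K ≤ V` (with orthogonal projection `ℓ`), `δ > 0`, a map `s : K → V` and an open set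
`O` with: `b ∈ O ⊆ U ∩ Ω`, `O ⊆ B(b, r)` with `B̄(b, r) ⊆ Ω` for some `r`, `s` holomorphic on the ball
`W = B(ℓ b, δ)` with `ℓ (s w) = w` there, and **`reg|T| ∩ O = s(W)`**: over `W`, the part of the
carrier in the tube `O` is exactly one holomorphic sheet (the orthogonally normalised chart at
`b`, cut down to the tube `B(b, r) ∩ ℓ⁻¹(W)`). [cite: Chirka1989, §2.3, p. 20; §16.1, p. 207] -/
theorem exists_sheet_nhds (T : HolomorphicChain 𝓘(ℂ, V) Ω (q + 1)) {b : V} (hb : b ∈ T.carrier)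
    {U : Set V} (hU : IsOpen U) (hbU : b ∈ U) :
    ∃ (K : Submodule ℂ V) (δ r : ℝ) (s : K → V) (O : Set V),
      finrank ℂ K = q + 1 ∧ 0 < δ ∧ 0 < r ∧ IsOpen O ∧ b ∈ O ∧ O ⊆ U ∧ O ⊆ ball b r ∧
      closedBall b r ⊆ (Ω : Set V) ∧
      DifferentiableOn ℂ s (ball (K.orthogonalProjectionOnto b) δ) ∧
      (∀ w ∈ ball (K.orthogonalProjectionOnto b) δ, K.orthogonalProjectionOnto (s w) = w) ∧
      (∀ w ∈ ball (K.orthogonalProjectionOnto b) δ, s w ∈ O) ∧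
      T.carrier ∩ O = s '' ball (K.orthogonalProjectionOnto b) δ ∧
      O = ball b r ∩ K.orthogonalProjectionOnto ⁻¹' ball (K.orthogonalProjectionOnto b) δ := by
  obtain ⟨K, ρ, Ψ, N, hKp, hρ, hNo, hbN, hNΩ, hΨd, hΨ0, -, hπΨ, hΨc, hcN⟩ := T.exists_orthoChart hb
  set ℓ : V →L[ℂ] K := K.orthogonalProjectionOnto with hℓ
  -- a ball `B(b, r)` with closure in `N ∩ U` (hence in `Ω`)
  obtain ⟨R, hR, hRsub⟩ := Metric.isOpen_iff.1 (hNo.inter hU) b ⟨hbN, hbU⟩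
  set r : ℝ := R / 2 with hr
  have hr0 : 0 < r := by positivity
  have hclosed : closedBall b r ⊆ N ∩ U := (closedBall_subset_ball (by rw [hr]; linarith)).trans hRsub
  -- the section `s w = Ψ (w - ℓ b)` over `B(ℓ b, ρ)`
  set s : K → V := fun w => Ψ (w - ℓ b) with hs
  have hshift : ∀ {δ' : ℝ} {w : K}, w ∈ ball (ℓ b) δ' → w - ℓ b ∈ ball (0 : K) δ' := by
    intro δ' w hw
    rwa [mem_ball, dist_eq_norm, sub_zero, ← dist_eq_norm]
  have hsd : DifferentiableOn ℂ s (ball (ℓ b) ρ) := by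
    refine hΨd.comp ((differentiable_id.sub_const _).differentiableOn) fun w hw => hshift hw
  have hℓs : ∀ w ∈ ball (ℓ b) ρ, ℓ (s w) = w := by
    intro w hw
    have h1 := hπΨ (w - ℓ b) (hshift hw)
    have h2 : ℓ (Ψ (w - ℓ b) - b) = ℓ (Ψ (w - ℓ b)) - ℓ b := map_sub ℓ _ _
    rw [h2] at h1
    show ℓ (Ψ (w - ℓ b)) = w
    exact sub_left_injective h1
  have hsb : s (ℓ b) = b := by simp [hs, hΨ0]
  -- continuity of `s` at `ℓ b`: a small ball `W = B(ℓ b, δ)` with `s(W) ⊆ B(b, r)`, `δ ≤ ρ`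
  have hsc : ContinuousAt s (ℓ b) :=
    (hsd.continuousOn.continuousAt (isOpen_ball.mem_nhds (mem_ball_self hρ)))
  have hpre : s ⁻¹' ball b r ∈ 𝓝 (ℓ b) := hsc (isOpen_ball.mem_nhds (by rw [hsb]; exact mem_ball_self hr0))
  obtain ⟨δ₀, hδ₀, hδ₀sub⟩ := Metric.mem_nhds_iff.1 hpre
  set δ : ℝ := min δ₀ ρ with hδ
  have hδ0 : 0 < δ := lt_min hδ₀ hρ
  have hδρ : ball (ℓ b) δ ⊆ ball (ℓ b) ρ := ball_subset_ball (min_le_right _ _)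
  have hδb : ∀ w ∈ ball (ℓ b) δ, s w ∈ ball b r := fun w hw =>
    hδ₀sub (ball_subset_ball (min_le_left _ _) hw)
  -- the tube
  set O : Set V := ball b r ∩ ℓ ⁻¹' ball (ℓ b) δ with hO
  have hOo : IsOpen O := isOpen_ball.inter (isOpen_ball.preimage ℓ.continuous)
  have hbO : b ∈ O := ⟨mem_ball_self hr0, by show ℓ b ∈ ball (ℓ b) δ; exact mem_ball_self hδ0⟩
  refine ⟨K, δ, r, s, O, hKp, hδ0, hr0, hOo, hbO, fun x hx => (hclosed (ball_subset_closedBall hx.1)).2,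
    inter_subset_left, fun x hx => hNΩ (hclosed hx).1, hsd.mono hδρ, fun w hw => hℓs w (hδρ hw),
    fun w hw => ⟨hδb w hw, by show ℓ (s w) ∈ ball (ℓ b) δ; rw [hℓs w (hδρ hw)]; exact hw⟩, ?_, rfl⟩
  -- `reg|T| ∩ O = s(W)`
  apply Subset.antisymm
  · rintro x ⟨hxc, hxb, hxℓ⟩
    have hxN : x ∈ N := (hclosed (ball_subset_closedBall hxb)).1
    obtain ⟨k, hk, rfl⟩ := hcN ⟨hxc, hxN⟩
    refine ⟨k + ℓ b, ?_, by simp [hs]⟩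
    have hk' : ℓ (Ψ k) = k + ℓ b := by
      have h1 := hπΨ k hk
      rw [map_sub] at h1
      rw [sub_eq_iff_eq_add] at h1
      exact h1
    have : ℓ (Ψ k) ∈ ball (ℓ b) δ := hxℓ
    rwa [hk'] at this
  · rintro _ ⟨w, hw, rfl⟩
    exact ⟨hΨc _ (hshift (hδρ hw)), hδb w hw, by
      show ℓ (s w) ∈ ball (ℓ b) δ; rw [hℓs w (hδρ hw)]; exact hw⟩

/-! ### Transport of null sets and of integrals along a sheet -/

section Transport

variable {K : Type*} [NormedAddCommGroup K] [InnerProductSpace ℂ K] [FiniteDimensional ℂ K]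
  [MeasurableSpace K] [BorelSpace K]

omit [FiniteDimensional ℂ V] [MeasurableSpace V] [BorelSpace V] [MeasurableSpace K] [BorelSpace K] in
/-- The real Jacobian of a complex-linear injection is positive: `(normDet L)² > 0`. [folklore] -/
private theorem normDet_sq_pos {L : K →ₗ[ℂ] V} (hL : Injective L) : 0 < L.normDet ^ 2 := by
  have h0 : L.normDet ≠ 0 := by
    rw [ne_eq, LinearMap.normDet_eq_zero_iff_ker_ne_bot, not_not]
    exact LinearMap.ker_eq_bot.2 hL
  positivity

omit [MeasurableSpace V] [BorelSpace V] [MeasurableSpace K] [BorelSpace K] in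
/-- The Jacobian `t ↦ (normDet ∂s(t))²` of a holomorphic map is continuous on its open domain
(it is the real Jacobian `normDet (∂s(t))_ℝ` of the `C¹` map `s`). [folklore] -/
private theorem continuousOn_normDet_sq {s : K → V} {W : Set K} (hW : IsOpen W)
    (hs : DifferentiableOn ℂ s W) :
    ContinuousOn (fun t => (fderiv ℂ s t : K →ₗ[ℂ] V).normDet ^ 2) W := by
  letI : InnerProductSpace ℝ K := InnerProductSpace.complexToReal
  letI : InnerProductSpace ℝ V := InnerProductSpace.complexToReal
  have hC1 : ContDiffOn ℝ 1 s W :=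
    ((Literature.Analysis.Complex.SCV.analyticOnNhd_of_differentiableOn hs hW).contDiffOn
      (n := 1) hW.uniqueDiffOn).restrict_scalars ℝ
  have hc : ContinuousOn (fun t => ((fderiv ℝ s t : K →L[ℝ] V) : K →ₗ[ℝ] V).normDet) W :=
    Literature.Analysis.Calculus.continuous_normDet.comp_continuousOn
      (hC1.continuousOn_fderiv_of_isOpen hW le_rfl)
  refine hc.congr fun t ht => ?_
  have hd : DifferentiableAt ℂ s t := hs.differentiableAt (hW.mem_nhds ht)
  show (fderiv ℂ s t : K →ₗ[ℂ] V).normDet ^ 2 = ((fderiv ℝ s t : K →L[ℝ] V) : K →ₗ[ℝ] V).normDet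
  rw [hd.fderiv_restrictScalars ℝ, ← normDet_restrictScalars_eq_normDet_sq]
  rfl

/-- **Null sets of a sheet pull back to null sets of the base.** Let `s` be an injective
holomorphic immersion of the open `W ⊆ K` (`dim_ℂ K = p`) into `V` and `S ⊆ W` measurable. If
`N ⊆ V` is `𝓗^{2p}`-null then `𝓗^{2p}(S ∩ s⁻¹ N) = 0` — by the area formula
`𝓗^{2p}(s(S) ∩ N') = ∫_{S ∩ s⁻¹N'} (normDet ∂s)²` with a measurable null hull `N' ⊇ N` and the
positivity of the Jacobian. [cite: Federer1969, 3.2.3, 3.2.5] -/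
theorem measure_inter_preimage_eq_zero_of_sheet {p : ℕ} (hK : finrank ℂ K = p) {s : K → V}
    {W : Set K} (hW : IsOpen W) (hs : DifferentiableOn ℂ s W) (hinj : InjOn s W)
    (himm : ∀ x ∈ W, Injective (fderiv ℂ s x)) {S : Set K} (hS : MeasurableSet S) (hSW : S ⊆ W)
    {N : Set V} (hN : (μHE[2 * p] : Measure V) N = 0) :
    (μHE[2 * p] : Measure K) (S ∩ s ⁻¹' N) = 0 := by
  subst hK
  set μ : Measure V := μHE[2 * finrank ℂ K] with hμ
  set N' : Set V := toMeasurable μ N with hN'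
  have hN'm : MeasurableSet N' := measurableSet_toMeasurable μ N
  have hN'0 : μ N' = 0 := by rw [hN', measure_toMeasurable]; exact hN
  -- area formula for the indicator of `N'`
  have key := lintegral_image_eq_lintegral_mul_normDet_sq_of_aemeasurable hW hs hinj himm hS hSW
    (g := N'.indicator 1) ((measurable_one.indicator hN'm).aemeasurable)
  have hL : ∫⁻ y in s '' S, N'.indicator 1 y ∂μ = 0 := by
    rw [lintegral_indicator hN'm, Measure.restrict_restrict hN'm]
    simp only [Pi.one_apply, lintegral_one, Measure.restrict_apply MeasurableSet.univ, univ_inter]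
    exact measure_mono_null inter_subset_left hN'0
  rw [hL] at key
  have hae : ∀ᵐ x ∂((μHE[2 * finrank ℂ K] : Measure K).restrict S),
      N'.indicator (1 : V → ℝ≥0∞) (s x) *
        ENNReal.ofReal ((fderiv ℂ s x : K →ₗ[ℂ] V).normDet ^ 2) = 0 := by
    refine (lintegral_eq_zero_iff' ?_).1 key.symm
    refine AEMeasurable.mul ?_ ?_
    · exact (measurable_one.indicator hN'm).comp_aemeasurable
        ((hs.continuousOn.mono hSW).aemeasurable hS)
    · exact ENNReal.measurable_ofReal.comp_aemeasurable
        (((continuousOn_normDet_sq hW hs).mono hSW).aemeasurable hS)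
  -- hence `s x ∉ N'` for a.e. `x ∈ S`
  have hae' : ∀ᵐ x ∂((μHE[2 * finrank ℂ K] : Measure K).restrict S), x ∈ S → s x ∉ N' := by
    filter_upwards [hae] with x hx hxS hxN
    rw [indicator_of_mem hxN, Pi.one_apply, one_mul, ENNReal.ofReal_eq_zero] at hx
    exact absurd hx (not_le.2 (normDet_sq_pos (himm x (hSW hxS))))
  have h1 : (μHE[2 * finrank ℂ K] : Measure K).restrict S (s ⁻¹' N') = 0 := by
    rw [measure_eq_zero_iff_ae_notMem]
    filter_upwards [hae', ae_restrict_mem hS] with x hx hxS using hx hxS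
  rw [Measure.restrict_apply' hS] at h1
  refine measure_mono_null (fun x hx => ?_) h1
  exact ⟨subset_toMeasurable μ N hx.2, hx.1⟩

/-- **A.e.-measurability transports to the base of a sheet**: if `h` is a.e.-strongly measurable
for `𝓗^{2p} ⌞ s(S)` then `h ∘ s` is a.e.-strongly measurable for `𝓗^{2p} ⌞ S` (a measurable
version of `h` differs from `h` on a null set of the sheet, whose preimage is null).
[cite: Federer1969, 3.2.5] -/
theorem aestronglyMeasurable_comp_sheet {p : ℕ} (hK : finrank ℂ K = p) {s : K → V}
    {W : Set K} (hW : IsOpen W) (hs : DifferentiableOn ℂ s W) (hinj : InjOn s W)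
    (himm : ∀ x ∈ W, Injective (fderiv ℂ s x)) {S : Set K} (hS : MeasurableSet S) (hSW : S ⊆ W)
    {F : Type*} [NormedAddCommGroup F] {h : V → F}
    (hh : AEStronglyMeasurable h ((μHE[2 * p] : Measure V).restrict (s '' S))) :
    AEStronglyMeasurable (h ∘ s) ((μHE[2 * p] : Measure K).restrict S) := by
  have hsm : AEMeasurable s ((μHE[2 * p] : Measure K).restrict S) :=
    (hs.continuousOn.mono hSW).aemeasurable hS
  have h1 : AEStronglyMeasurable (hh.mk h ∘ s) ((μHE[2 * p] : Measure K).restrict S) :=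
    hh.stronglyMeasurable_mk.aestronglyMeasurable.comp_aemeasurable hsm
  refine h1.congr ?_
  -- `h̃ ∘ s = h ∘ s` a.e. on `S`
  have hnull : (μHE[2 * p] : Measure V) ({y | h y ≠ hh.mk h y} ∩ s '' S) = 0 := by
    have h2 := hh.ae_eq_mk
    rw [Filter.EventuallyEq, ae_restrict_iff' (hS.image_of_continuousOn_injOn
      (hs.continuousOn.mono hSW) (hinj.mono hSW))] at h2
    rw [measure_eq_zero_iff_ae_notMem]
    filter_upwards [h2] with y hy hy'
    exact hy'.1 (hy hy'.2)
  have h0 := measure_inter_preimage_eq_zero_of_sheet hK hW hs hinj himm hS hSW hnull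
  rw [Filter.EventuallyEq, ae_restrict_iff' hS]
  rw [measure_eq_zero_iff_ae_notMem] at h0
  filter_upwards [h0] with x hx hxS
  by_contra hne
  exact hx ⟨hxS, ⟨fun h' => hne (by simp only [Function.comp_apply]; exact h'.symm), x, hxS, rfl⟩⟩

/-- **The area formula for Bochner integrals over a sheet** (Wirtinger form): for an injective
holomorphic immersion `s` of the open `W ⊆ K` (`dim_ℂ K = p`), measurable `S ⊆ W` and `h : V → ℝ`
integrable on `s(S)`,
`∫_{s(S)} h d𝓗^{2p} = ∫_S h(s t) · (normDet ∂s(t))² d𝓗^{2p}(t)`, and the right-hand integrand is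
integrable on `S`. [cite: Federer1969, 3.2.5] -/
theorem integral_image_sheet_eq {p : ℕ} (hK : finrank ℂ K = p) {s : K → V}
    {W : Set K} (hW : IsOpen W) (hs : DifferentiableOn ℂ s W) (hinj : InjOn s W)
    (himm : ∀ x ∈ W, Injective (fderiv ℂ s x)) {S : Set K} (hS : MeasurableSet S) (hSW : S ⊆ W)
    {h : V → ℝ} (hh : Integrable h ((μHE[2 * p] : Measure V).restrict (s '' S))) :
    Integrable (fun t => h (s t) * (fderiv ℂ s t : K →ₗ[ℂ] V).normDet ^ 2)
        ((μHE[2 * p] : Measure K).restrict S) ∧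
      ∫ y in s '' S, h y ∂(μHE[2 * p] : Measure V) =
        ∫ t in S, h (s t) * (fderiv ℂ s t : K →ₗ[ℂ] V).normDet ^ 2 ∂(μHE[2 * p] : Measure K) := by
  set μ : Measure V := (μHE[2 * p] : Measure V).restrict (s '' S) with hμ
  set ν : Measure K := (μHE[2 * p] : Measure K).restrict S with hν
  set J : K → ℝ := fun t => (fderiv ℂ s t : K →ₗ[ℂ] V).normDet ^ 2 with hJ
  have hJnn : ∀ t, 0 ≤ J t := fun t => sq_nonneg _
  have hJm : AEStronglyMeasurable J ν :=
    ((continuousOn_normDet_sq hW hs).mono hSW).aestronglyMeasurable hS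
  -- the `lintegral` area formula, for a.e.-measurable `g ≥ 0` on the sheet
  have AF : ∀ g : V → ℝ≥0∞, AEMeasurable g μ →
      ∫⁻ y, g y ∂μ = ∫⁻ t, g (s t) * ENNReal.ofReal (J t) ∂ν := by
    intro g hg
    have key := lintegral_image_eq_lintegral_mul_normDet_sq_of_aemeasurable hW hs hinj himm hS hSW
      (g := g) (by rw [hK]; exact hg)
    rw [hK] at key
    exact key
  -- measurability of `h ∘ s` on the base
  have hhs : AEStronglyMeasurable (h ∘ s) ν :=
    aestronglyMeasurable_comp_sheet hK hW hs hinj himm hS hSW hh.1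
  have hprod : AEStronglyMeasurable (fun t => h (s t) * J t) ν := hhs.mul hJm
  -- integrability on the base: `∫ |h ∘ s| J = ∫ |h| < ∞`
  have hfin : ∫⁻ t, ‖h (s t) * J t‖ₑ ∂ν < ⊤ := by
    have h1 : ∫⁻ t, ‖h (s t) * J t‖ₑ ∂ν = ∫⁻ t, ‖h (s t)‖ₑ * ENNReal.ofReal (J t) ∂ν := by
      refine lintegral_congr fun t => ?_
      rw [enorm_mul, Real.enorm_of_nonneg (hJnn t)]
    rw [h1, ← AF (fun y => ‖h y‖ₑ) hh.1.enorm]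
    exact hh.2
  have hint : Integrable (fun t => h (s t) * J t) ν := ⟨hprod, hfin⟩
  refine ⟨hint, ?_⟩
  -- split into positive and negative parts
  rw [integral_eq_lintegral_pos_part_sub_lintegral_neg_part hh,
    integral_eq_lintegral_pos_part_sub_lintegral_neg_part hint]
  have hpos : ∫⁻ y, ENNReal.ofReal (h y) ∂μ = ∫⁻ t, ENNReal.ofReal (h (s t) * J t) ∂ν := by
    rw [AF _ hh.1.aemeasurable.ennreal_ofReal]
    refine lintegral_congr fun t => ?_
    rw [ENNReal.ofReal_mul' (hJnn t)]
  have hneg : ∫⁻ y, ENNReal.ofReal (-h y) ∂μ = ∫⁻ t, ENNReal.ofReal (-(h (s t) * J t)) ∂ν := by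
    rw [AF (fun y => ENNReal.ofReal (-h y)) hh.1.aemeasurable.neg.ennreal_ofReal]
    refine lintegral_congr fun t => ?_
    rw [← neg_mul, ENNReal.ofReal_mul' (hJnn t)]
  rw [hpos, hneg]

end Transport

end HolomorphicChain

end Literature.Geometry.Kaehler

end
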